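import Summits.QuantumFields.BalabanUV.Beta.EriceRemainderEnclosureHistoryAutonomyComparisonDefect
import Summits.QuantumFields.BalabanUV.Beta.EriceRemainderEnclosureHistoryAutonomyComparisonWitness

/-!
# EriceRemainderEnclosureHistoryAutonomyComparisonDefectSharp — (E140b) **THE TWO-SIDED LAW `θ·ε_hi ≤ ε_lo` IS EXACT, AND (E49b) IS ITS ENDPOINT `ε_lo = 0`.**
# (E49b)'s isotone one-age hinge `B_M(u) = 1 + M·max(4 − 1∕u₁², 0)` (floor `1`, zeroth moment `16M`, LEVEL-LIPSCHITZ with the one-age profile `Λ₁ = M`, age moment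
# `θ = M`) perturbed by the SIGN-FREE two-level excess `ε + σ·min(max(8∕u₀² − 17, 0), 1)` (a floor `ε ≥ 0` plus (E49b)'s UV-activated Markov switch of amplitude
# `σ ≥ 0`: two-sided bounds `ε_lo = ε ≤ B′ − B_M ≤ ε + σ = ε_hi`, isotonicity defect exactly `τ = σ∕ε`; (E49b) is `ε = 0`).  From the pin `1` both flows have
# EXPLICIT box solutions (levels `1, 2 + M∕(1+M), 3 + M∕(1+M), …` and `1, 2 + q, 3 + q + (ε+σ), 4 + q + 2(ε+σ), …`, `q = (M(1−ε−σ) + ε)∕(1+M)`), and the scale-1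
# levels differ by `(M(ε+σ) − ε)∕(1+M)`: **comparison FAILS at scale 1 iff `M·(ε+σ) > ε`, i.e. iff `θ·ε_hi > ε_lo`** (`hM_one_lt_hD_one`).  Conversely, for
# `M(ε+σ) ≤ ε` (E140a) `le_of_two_sided_excess` gives comparison for EVERY pair of box solutions from EVERY pin — so on this family the two-sided law of (E140a) is
# an EQUIVALENCE (`two_sided_dichotomy`), exactly as (E138d)∕(E139h) are for the moment and the Markov-credit laws.

Cell `pub-balaban`, β-function sub-cell, BINDER row D4 «RemainderConst leaves for Bałaban's split» (`HOME/BINDER-OWNERS.md`; owner lineage `b2b-balaban-beta-an4`;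
this file by co-owner #2 lineage `b2b-balaban-beta-d4-p2`, generation 108), β-FLOW TEAM duty (1), FREEZE (0) honoured (def-free: functionals and histories are explicit
lambdas as in (E49b); (E49b) `memMap_*` ∕ `switch_*` ∕ `one_le_BM` ∕ `BM_isotone` ∕ `BM_zerothMoment` ∕ `memFlow_of_levels` ∕ `seqBox_of_levels` ∕ `eight_div_sq` ∕
`levels_pos` ∕ `memFlow_hM`, (E140a) `le_of_two_sided_excess` BY NAME; nothing restated).

HONEST FRAMING (page 1, verbatim and binding).  *"Discharging BetaPertH makes Bałaban's UV stability UNCONDITIONAL — a real constructive-QFT result; it is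
NOT the continuum limit and NOT the Clay problem."*  THIS FILE DISCHARGES NOTHING OF THE KIND.  A [folklore] TOY: explicit Lipschitz functionals on ]0,1]^ℕ and their
explicit box solutions — nothing of Bałaban's (1.22), of Erice's β_n, or of the sign ∕ two-sided size of any remainder perturbation of Bałaban's limit functional (NOT
PRINTED; [I] p. 298; GAPS G-t4-U2-1∕-2).  Row D4 class UNCHANGED (critical-path width 0; instance 0∕1; D4 DISCHARGE NO DATE).  NOT B12 Thm 2, NOT BetaPertH, NOT
continuum YM, NOT Clay.

THE COMPUTATION (levels `a = 1∕h²`).  Base: `a_{m+1} = a_m + 1 + M·max(4 − a_{m+2}, 0)`; from `a₀ = 1` the hinge fires at scale 0 only.  Perturbed: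
`a′_{m+1} = a′_m + 1 + M·max(4 − a′_{m+2}, 0) + ε + σ·sw(a′_{m+1})` with the switch OFF at `a′₁ = 2 + q ≤ 17∕8` (`M, ε ≤ 1∕16`) and ON from scale 2 (`a′₂ ≥ 3`); the
hinge reads `a′₂ = 3 + q + ε + σ ≤ 4` at scale 0 (`ε + σ ≤ 1∕2`) and is silent below.  Fixed point at scale 1: `a′₁(1+M) = 2 + 3M + ε − M(ε+σ)·1 …`, i.e.
`q(1+M) = M(1−ε−σ) + ε`, and `a₁ − a′₁ = M∕(1+M) − q = (M(ε+σ) − ε)∕(1+M)`: the UV switch `σ` LOWERS `h′₂`, the isotone memory at scale 0 reads it and returns LESS by `Mσ`,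
the floor `ε` pushes the other way by `ε(1 − M)`… net `M(ε+σ) − ε` before the fixed-point factor.

WHAT IS PROVED ([folklore]; 0 `def`, 0 sorry).  §1 `BM_le_BD`, `one_le_BD`, `BD_le`, `excess_two_sided`, `BM_profile`, `BM_moment`.  §2 `levelsD_nonneg_q`, `levelsD_pos`,
`levelsD_rec`, **`memFlow_hD`**.  §3 `level_one_sub_levelD_one`, **`hM_one_lt_hD_one`** (violation iff-direction), `hD_le_hM_of_law` (the explicit pair compares under the
law, directly).  §4 **`le_of_law`** ((E140a) on the family, every pin), **`two_sided_dichotomy`** (the IFF).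
-/

noncomputable section
open Finset Set

namespace Summit.QuantumFields.BalabanUV.Beta.EriceRemainderEnclosureHistoryAutonomyComparisonDefectSharp

open Literature.MathematicalPhysics.QuantumFieldTheory.Balaban1983to89
open Literature.MathematicalPhysics.QuantumFieldTheory.Balaban1983to89.T4BetaStationary
open Literature.MathematicalPhysics.QuantumFieldTheory.Balaban1983to89.T4BetaFlowWellPosed
open Summit.QuantumFields.BalabanUV.Beta.EriceRemainderEnclosureHistoryAutonomyComparisonWitness
  (memMap_nonneg memMap_le_three memMap_mono abs_memMap_sub_le switch_mem switch_eq_zero switch_eq_one one_le_BM BM_isotone BM_zerothMoment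
    memFlow_of_levels seqBox_of_levels eight_div_sq levels_pos memFlow_hM)
open Summit.QuantumFields.BalabanUV.Beta.EriceRemainderEnclosureHistoryAutonomyComparisonDefect (le_of_two_sided_excess)

variable {M ε σ : ℝ}

/-! ## §1 The sign-free two-level perturbation `B′ = B_M + ε + σ·switch` and the one-age profile of `B_M` -/

/-- `B_M ≤ B′ = B_M + ε + σ·min(max(8∕u₀² − 17, 0), 1)` on every configuration (`ε, σ ≥ 0`). [folklore] -/
theorem BM_le_BD (hε : 0 ≤ ε) (hσ : 0 ≤ σ) (u : ℕ → ℝ) :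
    (fun w : ℕ → ℝ => 1 + M * max (4 - 1 / w 1 ^ 2) 0) u ≤
      (fun w : ℕ → ℝ => 1 + M * max (4 - 1 / w 1 ^ 2) 0 + (ε + σ * min (max (8 / w 0 ^ 2 - 17) 0) 1)) u := by
  simp only
  have := (switch_mem (1 / u 0 ^ 2)).1
  rw [show (8 : ℝ) * (1 / u 0 ^ 2) = 8 / u 0 ^ 2 by ring] at this
  nlinarith

/-- `B′` has floor `1` (`M, ε, σ ≥ 0`). [folklore] -/
theorem one_le_BD (hM : 0 ≤ M) (hε : 0 ≤ ε) (hσ : 0 ≤ σ) (u : ℕ → ℝ) :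
    1 ≤ (fun w : ℕ → ℝ => 1 + M * max (4 - 1 / w 1 ^ 2) 0 + (ε + σ * min (max (8 / w 0 ^ 2 - 17) 0) 1)) u :=
  (one_le_BM hM u).trans (BM_le_BD hε hσ u)

/-- `B′ ≤ 1 + 3M + ε + σ` on the box ]0,1]. [folklore] -/
theorem BD_le (hM : 0 ≤ M) (hσ : 0 ≤ σ) (u : ℕ → ℝ) (hu : SeqBox 1 u) :
    (fun w : ℕ → ℝ => 1 + M * max (4 - 1 / w 1 ^ 2) 0 + (ε + σ * min (max (8 / w 0 ^ 2 - 17) 0) 1)) u ≤ 1 + 3 * M + ε + σ := by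
  simp only
  have h3 := memMap_le_three (hu 1).1 (hu 1).2
  have hs := (switch_mem (1 / u 0 ^ 2)).2
  rw [show (8 : ℝ) * (1 / u 0 ^ 2) = 8 / u 0 ^ 2 by ring] at hs
  nlinarith

/-- **THE EXCESS IS TWO-SIDED AND SIGN-FREE: `ε ≤ B′ u − B_M u ≤ ε + σ`** (both bounds attained: the switch is `0` at levels `≤ 17∕8` and `1` at levels `≥ 9∕4`; it is
ANTITONE in the history — it grows towards the ultraviolet — so the excess is NOT isotone unless `σ = 0`). [folklore] -/
theorem excess_two_sided (hσ : 0 ≤ σ) (u : ℕ → ℝ) :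
    ε ≤ (fun w : ℕ → ℝ => 1 + M * max (4 - 1 / w 1 ^ 2) 0 + (ε + σ * min (max (8 / w 0 ^ 2 - 17) 0) 1)) u
        - (fun w : ℕ → ℝ => 1 + M * max (4 - 1 / w 1 ^ 2) 0) u ∧
      (fun w : ℕ → ℝ => 1 + M * max (4 - 1 / w 1 ^ 2) 0 + (ε + σ * min (max (8 / w 0 ^ 2 - 17) 0) 1)) u
        - (fun w : ℕ → ℝ => 1 + M * max (4 - 1 / w 1 ^ 2) 0) u ≤ ε + σ := by
  simp only
  have hs := switch_mem (1 / u 0 ^ 2)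
  rw [show (8 : ℝ) * (1 / u 0 ^ 2) = 8 / u 0 ^ 2 by ring] at hs
  constructor <;> nlinarith [hs.1, hs.2]

/-- **THE LEVEL-LIPSCHITZ PROFILE OF `B_M` IS THE ONE-AGE PROFILE `Λ₁ = M`** (in (E138)∕(E140a)'s form, `K = 2`, `Λ = (0, M)`; the graded-box provisos are not needed):
`B_M u − B_M v ≤ M·(1∕v₁² − 1∕u₁²)⁺` — the hinge `x ↦ max(4 − x, 0)` is antitone and `1`-Lipschitz in the level. [folklore] -/
theorem BM_profile (hM : 0 ≤ M) :
    ∀ u v : ℕ → ℝ, SeqBox 1 u → SeqBox 1 v → (∀ k : ℕ, 1 / (1 : ℝ) ^ 2 + ((k : ℝ) + 1) * 1 ≤ 1 / u k ^ 2) →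
      (∀ k : ℕ, 1 / (1 : ℝ) ^ 2 + ((k : ℝ) + 1) * 1 ≤ 1 / v k ^ 2) →
      (fun w : ℕ → ℝ => 1 + M * max (4 - 1 / w 1 ^ 2) 0) u - (fun w : ℕ → ℝ => 1 + M * max (4 - 1 / w 1 ^ 2) 0) v
        ≤ ∑ k ∈ range 2, (if k = 1 then M else 0) * max (1 / v k ^ 2 - 1 / u k ^ 2) 0 := by
  intro u v _ _ _ _
  rw [sum_range_succ, sum_range_succ, sum_range_zero, zero_add, if_neg (zero_ne_one : (0 : ℕ) ≠ 1), if_pos rfl, zero_mul, zero_add]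
  have hmap : max (4 - 1 / u 1 ^ 2) 0 - max (4 - 1 / v 1 ^ 2) 0 ≤ max (1 / v 1 ^ 2 - 1 / u 1 ^ 2) 0 := by
    rcases le_or_gt (4 - 1 / u 1 ^ 2) 0 with hu0 | hu0
    · rw [max_eq_right hu0]; linarith [le_max_right (4 - 1 / v 1 ^ 2) 0, le_max_right (1 / v 1 ^ 2 - 1 / u 1 ^ 2) 0]
    · rw [max_eq_left hu0.le]
      linarith [le_max_left (4 - 1 / v 1 ^ 2) 0, le_max_left (1 / v 1 ^ 2 - 1 / u 1 ^ 2) 0]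
  nlinarith [hmap]

/-- THE AGE MOMENT OF THAT PROFILE IS `θ = M`. [folklore] -/
theorem BM_moment (M : ℝ) : ∑ k ∈ range 2, (k : ℝ) * (if k = 1 then M else 0) = M := by
  simp

/-! ## §2 The explicit box solution `h′` of `B′` from the pin `1` -/

/-- The scale-1 offset `q = (M(1−ε−σ) + ε)∕(1+M)` lies in `[0, 1∕8]` for `0 ≤ M ≤ 1∕16`, `0 ≤ ε ≤ 1∕16`, `0 ≤ σ`, `ε + σ ≤ 1∕2`. [folklore] -/
theorem levelsD_nonneg_q (hM : 0 ≤ M) (hM16 : M ≤ 1 / 16) (hε : 0 ≤ ε) (hε16 : ε ≤ 1 / 16) (hσ : 0 ≤ σ) (hεσ : ε + σ ≤ 1 / 2) :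
    0 ≤ (M * (1 - ε - σ) + ε) / (1 + M) ∧ (M * (1 - ε - σ) + ε) / (1 + M) ≤ 1 / 8 := by
  have hM1 : (0 : ℝ) < 1 + M := by linarith
  refine ⟨div_nonneg (by nlinarith) hM1.le, ?_⟩
  rw [div_le_iff₀ hM1]
  nlinarith

/-- THE LEVELS OF `h′`: `1, 2 + q, 3 + q + (ε+σ), 4 + q + 2(ε+σ), …` — at least `1` (box ]0,1]). [folklore] -/
theorem levelsD_pos (hM : 0 ≤ M) (hM16 : M ≤ 1 / 16) (hε : 0 ≤ ε) (hε16 : ε ≤ 1 / 16) (hσ : 0 ≤ σ) (hεσ : ε + σ ≤ 1 / 2) (j : ℕ) :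
    1 ≤ (if j = 0 then (1 : ℝ) else 1 + j + ((j : ℝ) - 1) * (ε + σ) + (M * (1 - ε - σ) + ε) / (1 + M)) := by
  split_ifs with hj
  · exact le_rfl
  · have hq := (levelsD_nonneg_q hM hM16 hε hε16 hσ hεσ).1
    have : (1 : ℝ) ≤ j := by exact_mod_cast Nat.one_le_iff_ne_zero.mpr hj
    nlinarith

/-- THE LEVEL RECURSION OF `h′` (`0 ≤ M ≤ 1∕16`, `0 ≤ ε ≤ 1∕16`, `σ ≥ 0`, `ε + σ ≤ 1∕2`): at scale `0` the switch is OFF (level `2 + q ≤ 17∕8`) and the memory reads the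
future level `3 + q + ε + σ ≤ 4`, contributing `M(1 − q − ε − σ)`; from scale `1` on the switch is ON (levels `≥ 3`) and the memory SILENT (future levels `≥ 4`). [folklore] -/
theorem levelsD_rec (hM : 0 ≤ M) (hM16 : M ≤ 1 / 16) (hε : 0 ≤ ε) (hε16 : ε ≤ 1 / 16) (hσ : 0 ≤ σ) (hεσ : ε + σ ≤ 1 / 2) (m : ℕ) :
    (if m + 1 = 0 then (1 : ℝ) else 1 + (m + 1 : ℕ) + (((m + 1 : ℕ) : ℝ) - 1) * (ε + σ) + (M * (1 - ε - σ) + ε) / (1 + M)) =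
      (if m = 0 then (1 : ℝ) else 1 + (m : ℕ) + ((m : ℝ) - 1) * (ε + σ) + (M * (1 - ε - σ) + ε) / (1 + M)) +
        (1 + M * max (4 - (if m + 1 + 1 = 0 then (1 : ℝ) else
              1 + (m + 1 + 1 : ℕ) + (((m + 1 + 1 : ℕ) : ℝ) - 1) * (ε + σ) + (M * (1 - ε - σ) + ε) / (1 + M))) 0 +
          (ε + σ * min (max (8 * (if m + 1 = 0 then (1 : ℝ) else
              1 + (m + 1 : ℕ) + (((m + 1 : ℕ) : ℝ) - 1) * (ε + σ) + (M * (1 - ε - σ) + ε) / (1 + M)) - 17) 0) 1)) := by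
  have hM1 : (0 : ℝ) < 1 + M := by linarith
  obtain ⟨hq, hq8⟩ := levelsD_nonneg_q hM hM16 hε hε16 hσ hεσ
  set q : ℝ := (M * (1 - ε - σ) + ε) / (1 + M) with hqdef
  have hqM : q * (1 + M) = M * (1 - ε - σ) + ε := by rw [hqdef]; field_simp
  rw [if_neg (Nat.succ_ne_zero m), if_neg (by omega : m + 1 + 1 ≠ 0)]
  rcases Nat.eq_zero_or_pos m with rfl | hm
  · rw [if_pos rfl]
    have e1 : max ((4 : ℝ) - (1 + ((0 + 1 + 1 : ℕ) : ℝ) + (((0 + 1 + 1 : ℕ) : ℝ) - 1) * (ε + σ) + q)) 0 = 1 - (ε + σ) - q := by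
      refine (max_eq_left ?_).trans ?_
      · push_cast; linarith
      · push_cast; ring
    have e2 : min (max (8 * ((1 : ℝ) + ((0 + 1 : ℕ) : ℝ) + (((0 + 1 : ℕ) : ℝ) - 1) * (ε + σ) + q) - 17) 0) 1 = 0 :=
      switch_eq_zero (by push_cast; linarith)
    rw [e1, e2]
    push_cast
    nlinarith [hqM]
  · rw [if_neg (by omega : m ≠ 0)]
    have hm1 : (1 : ℝ) ≤ m := by exact_mod_cast hm
    have hεσ0 : 0 ≤ ε + σ := by linarith
    have e1 : max ((4 : ℝ) - (1 + ((m + 1 + 1 : ℕ) : ℝ) + (((m + 1 + 1 : ℕ) : ℝ) - 1) * (ε + σ) + q)) 0 = 0 := by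
      refine max_eq_right ?_
      push_cast; nlinarith
    have e2 : min (max (8 * ((1 : ℝ) + ((m + 1 : ℕ) : ℝ) + (((m + 1 : ℕ) : ℝ) - 1) * (ε + σ) + q) - 17) 0) 1 = 1 :=
      switch_eq_one (by push_cast; nlinarith)
    rw [e1, e2]; push_cast; ring

/-- **`h′` IS A BOX SOLUTION OF `B′ = B_M + ε + σ·switch` FROM THE PIN `1`** (`0 ≤ M ≤ 1∕16`, `0 ≤ ε ≤ 1∕16`, `σ ≥ 0`, `ε + σ ≤ 1∕2`). [folklore] -/
theorem memFlow_hD (hM : 0 ≤ M) (hM16 : M ≤ 1 / 16) (hε : 0 ≤ ε) (hε16 : ε ≤ 1 / 16) (hσ : 0 ≤ σ) (hεσ : ε + σ ≤ 1 / 2) :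
    SeqBox 1 (fun j : ℕ => 1 / Real.sqrt
        (if j = 0 then (1 : ℝ) else 1 + j + ((j : ℝ) - 1) * (ε + σ) + (M * (1 - ε - σ) + ε) / (1 + M))) ∧
      MemFlow (fun w : ℕ → ℝ => 1 + M * max (4 - 1 / w 1 ^ 2) 0 + (ε + σ * min (max (8 / w 0 ^ 2 - 17) 0) 1)) 1
        (fun j : ℕ => 1 / Real.sqrt
          (if j = 0 then (1 : ℝ) else 1 + j + ((j : ℝ) - 1) * (ε + σ) + (M * (1 - ε - σ) + ε) / (1 + M))) := by
  have hpos : ∀ j : ℕ, 0 < (if j = 0 then (1 : ℝ) else 1 + j + ((j : ℝ) - 1) * (ε + σ) + (M * (1 - ε - σ) + ε) / (1 + M)) :=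
    fun j => one_pos.trans_le (levelsD_pos hM hM16 hε hε16 hσ hεσ j)
  refine ⟨seqBox_of_levels (levelsD_pos hM hM16 hε hε16 hσ hεσ), memFlow_of_levels one_pos hpos (by simp) fun m => ?_⟩
  simp only [one_div_sq_one_div_sqrt (hpos _), eight_div_sq _ (hpos _), add_zero]
  exact levelsD_rec hM hM16 hε hε16 hσ hεσ m

/-! ## §3 The scale-1 reading: violation iff `M(ε+σ) > ε` -/

/-- THE SCALE-1 LEVELS DIFFER BY `(M(ε+σ) − ε)∕(1+M)` in favour of the SMALLER functional when positive. [folklore] -/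
theorem level_one_sub_levelD_one (hM : 0 ≤ M) (ε σ : ℝ) :
    ((1 : ℝ) + (1 : ℕ) + M / (1 + M)) - (1 + (1 : ℕ) + (((1 : ℕ) : ℝ) - 1) * (ε + σ) + (M * (1 - ε - σ) + ε) / (1 + M))
      = (M * (ε + σ) - ε) / (1 + M) := by
  have hM1 : (1 : ℝ) + M ≠ 0 := by linarith
  push_cast; field_simp; ring

/-- **COMPARISON FAILS AT SCALE 1 WHEN `M·(ε+σ) > ε`** (`θ·ε_hi > ε_lo`): `B_M ≤ B′` on the box, yet `h_M 1 < h′ 1`.  At `ε = 0` this is (E49b) (`Mσ > 0`): the two-sided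
law's endpoint. [folklore] -/
theorem hM_one_lt_hD_one (hM : 0 ≤ M) (hM16 : M ≤ 1 / 16) (hε : 0 ≤ ε) (hε16 : ε ≤ 1 / 16) (hσ : 0 ≤ σ) (hεσ : ε + σ ≤ 1 / 2)
    (hviol : ε < M * (ε + σ)) :
    (fun j : ℕ => 1 / Real.sqrt (if j = 0 then (1 : ℝ) else 1 + j + M / (1 + M))) 1 <
      (fun j : ℕ => 1 / Real.sqrt
        (if j = 0 then (1 : ℝ) else 1 + j + ((j : ℝ) - 1) * (ε + σ) + (M * (1 - ε - σ) + ε) / (1 + M))) 1 := by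
  simp only [if_neg (one_ne_zero : (1 : ℕ) ≠ 0), Nat.cast_one, sub_self, zero_mul, add_zero]
  have hM1 : (0 : ℝ) < 1 + M := by linarith
  have hq := (levelsD_nonneg_q hM hM16 hε hε16 hσ hεσ).1
  have hlt : (1 : ℝ) + 1 + (M * (1 - ε - σ) + ε) / (1 + M) < 1 + 1 + M / (1 + M) := by
    have : (M * (1 - ε - σ) + ε) / (1 + M) < M / (1 + M) := by
      rw [div_lt_div_iff_of_pos_right hM1]; nlinarith
    linarith
  have hpos : (0 : ℝ) < 1 + 1 + (M * (1 - ε - σ) + ε) / (1 + M) := by linarith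
  exact one_div_lt_one_div_of_lt (Real.sqrt_pos.mpr hpos) (Real.sqrt_lt_sqrt hpos.le hlt)

/-- Under the law `M(ε+σ) ≤ ε` the explicit pair compares at every scale, by direct reading of the levels (`a′_j − a_j = (ε − M(ε+σ))∕(1+M) + (j−1)(ε+σ) ≥ 0`,
`j ≥ 1`; no range restriction needed for this direction). [folklore] -/
theorem hD_le_hM_of_law (hM : 0 ≤ M) (hε : 0 ≤ ε) (hσ : 0 ≤ σ) (hlaw : M * (ε + σ) ≤ ε) (j : ℕ) :
    (fun j : ℕ => 1 / Real.sqrt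
        (if j = 0 then (1 : ℝ) else 1 + j + ((j : ℝ) - 1) * (ε + σ) + (M * (1 - ε - σ) + ε) / (1 + M))) j ≤
      (fun j : ℕ => 1 / Real.sqrt (if j = 0 then (1 : ℝ) else 1 + j + M / (1 + M))) j := by
  simp only
  rcases Nat.eq_zero_or_pos j with rfl | hj
  · simp
  · rw [if_neg (by omega : j ≠ 0), if_neg (by omega : j ≠ 0)]
    have hM1 : (0 : ℝ) < 1 + M := by linarith
    have hj1 : (1 : ℝ) ≤ j := by exact_mod_cast hj
    have hpos : (0 : ℝ) < 1 + j + M / (1 + M) := by positivity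
    have hle : (1 : ℝ) + j + M / (1 + M) ≤ 1 + j + ((j : ℝ) - 1) * (ε + σ) + (M * (1 - ε - σ) + ε) / (1 + M) := by
      have e : (M * (1 - ε - σ) + ε) / (1 + M) = M / (1 + M) + (ε - M * (ε + σ)) / (1 + M) := by
        field_simp; ring
      have h1 : 0 ≤ (ε - M * (ε + σ)) / (1 + M) := div_nonneg (by linarith) hM1.le
      have h2 : 0 ≤ ((j : ℝ) - 1) * (ε + σ) := mul_nonneg (by linarith) (by linarith)
      rw [e]; linarith
    exact one_div_le_one_div_of_le (Real.sqrt_pos.mpr hpos) (Real.sqrt_le_sqrt hle)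

/-! ## §4 (E140a) on the family, and the dichotomy -/

/-- **THE LAW GIVES COMPARISON FROM EVERY PIN** — (E140a) `le_of_two_sided_excess` instantiated: `B_M` is isotone with zeroth moment `16M`, floor `1`, one-age profile
`Λ₁ = M` (`θ = M`); the excess of `B′` is two-sided, `ε ≤ B′ − B_M ≤ ε + σ`; so `M(ε+σ) ≤ ε` and `ε > 0` give `h′ ≤ h` for ANY box solutions from ANY common pin
`p ∈ ]0,1]`. [folklore] -/
theorem le_of_law (hM : 0 ≤ M) (hε : 0 < ε) (hσ : 0 ≤ σ) (hlaw : M * (ε + σ) ≤ ε) {p : ℝ} (hp : 0 < p) (hp1 : p ≤ 1)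
    {h h' : ℕ → ℝ} (hh : SeqBox 1 h) (hf : MemFlow (fun w : ℕ → ℝ => 1 + M * max (4 - 1 / w 1 ^ 2) 0) p h)
    (hh' : SeqBox 1 h')
    (hf' : MemFlow (fun w : ℕ → ℝ => 1 + M * max (4 - 1 / w 1 ^ 2) 0 + (ε + σ * min (max (8 / w 0 ^ 2 - 17) 0) 1)) p h') (j : ℕ) :
    h' j ≤ h j := by
  have hΛ : ∀ k : ℕ, 0 ≤ (if k = 1 then M else 0) := fun k => by split_ifs <;> [exact hM; exact le_rfl]
  have hθε : (∑ k ∈ range 2, (k : ℝ) * (if k = 1 then M else 0)) * (ε + σ) ≤ ε := by rw [BM_moment]; exact hlaw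
  exact le_of_two_sided_excess (γ := 1) (b := 1) (βb := 1 + 3 * M + ε + σ) (BM_isotone hM) (BM_zerothMoment hM) (by positivity) one_pos
    (fun u _ => one_le_BM hM u) hΛ hε hθε (by simpa only [one_pow] using BM_profile hM)
    (fun u _ => excess_two_sided hσ u) (fun u hu => BD_le hM hσ u hu) hp hp1 hh hf hh' hf' j

/-- **THE TWO-SIDED LAW IS EXACT ON THIS FAMILY (an IFF).**  For `0 ≤ M ≤ 1∕16`, `0 < ε ≤ 1∕16`, `σ ≥ 0`, `ε + σ ≤ 1∕2`:
**`M·(ε+σ) ≤ ε`  ⟺  every pair of box solutions (`h` of `B_M`, `h′` of `B_M + ε + σ·switch`) from every common pin `p ∈ ]0,1]` satisfies `h′ ≤ h` at every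
scale.**  `⟹`: (E140a) (`le_of_law`).  `⟸`: at the pin `1` the explicit pair has `h_M 1 < h′ 1` as soon as `M(ε+σ) > ε` (`hM_one_lt_hD_one`).  In (E140a)'s letters:
`θ = M`, `ε_lo = ε`, `ε_hi = ε + σ`, defect `τ = σ∕ε` — the law `θ·ε_hi ≤ ε_lo`, alias `θ(1+τ) ≤ 1`, cannot be improved. [folklore] -/
theorem two_sided_dichotomy (hM : 0 ≤ M) (hM16 : M ≤ 1 / 16) (hε : 0 < ε) (hε16 : ε ≤ 1 / 16) (hσ : 0 ≤ σ) (hεσ : ε + σ ≤ 1 / 2) :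
    M * (ε + σ) ≤ ε ↔
      ∀ p : ℝ, 0 < p → p ≤ 1 → ∀ h h' : ℕ → ℝ, SeqBox 1 h →
        MemFlow (fun w : ℕ → ℝ => 1 + M * max (4 - 1 / w 1 ^ 2) 0) p h → SeqBox 1 h' →
        MemFlow (fun w : ℕ → ℝ => 1 + M * max (4 - 1 / w 1 ^ 2) 0 + (ε + σ * min (max (8 / w 0 ^ 2 - 17) 0) 1)) p h' →
        ∀ j, h' j ≤ h j := by
  constructor
  · intro hlaw p hp hp1 h h' hh hf hh' hf' j
    exact le_of_law hM hε hσ hlaw hp hp1 hh hf hh' hf' j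
  · intro hall
    by_contra hlt
    have hviol : ε < M * (ε + σ) := lt_of_not_ge hlt
    obtain ⟨hhb, hhf⟩ := memFlow_hM hM
    obtain ⟨hh'b, hh'f⟩ := memFlow_hD hM hM16 hε.le hε16 hσ hεσ
    have hle := hall 1 one_pos le_rfl _ _ hhb hhf hh'b hh'f 1
    exact absurd hle (not_le.mpr (hM_one_lt_hD_one hM hM16 hε.le hε16 hσ hεσ hviol))

end Summit.QuantumFields.BalabanUV.Beta.EriceRemainderEnclosureHistoryAutonomyComparisonDefectSharp

end
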